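import Mathlib

/-!
# Twin Hall gate — the two bookkeeping lemmas (LEMMA T, LEMMA K) as abstract finite-sum statements

Companion of `Cruxes/BlochSeedDiscOne/TWIN-HALL-GATE-embed-g3.md` v1.1 (§3, §3b), seat `plan-lens-HodgeAV-embed-g3`
(explicit-unit, block E4 «change the CM»). **Nothing here is proved toward HC / HC_CM / HC_AV / №4 / 26512 / 18881 / H2.**
These are the purely combinatorial identities behind the two pen lemmas of the memo, over an arbitrary finite
index type `ι` of "cells", a degree functional `ℓ : ι → ℚ`, flows and slacks. No geometry is formalised: the
geometric inputs (ℓ(ν) = ∫ ch₁(ν)·h⁷/7! is additive with ℓ(x ⊠ y) = c_F (tr x + tr y); a live pair p < n has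
ℓ p < ℓ n; ℓ(target) = ℓ(h)·q₁ = 0; |c_TT(cell)| ≤ λ_max) are hypotheses of the memo, checked there by exact
arithmetic, and enter below only as the abstract hypotheses `hsupp`, `hstrict`, `hgap`, `hΛ`.

* `lemmaT_identity`, `lemmaT_nonneg`, `lemmaT_rigid` — Hall-UP (cokernel) bookkeeping:
  `M⁺ n = Σ_p f p n + s n`, `M⁻ p = Σ_n f p n`; then
  `ℓ(E) = Σ_n M⁺ n · ℓ n − Σ_p M⁻ p · ℓ p = Σ_{p,n} f p n (ℓ n − ℓ p) + Σ_n s n ℓ n ≥ 0`,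
  and `ℓ(E) = 0` forces `f p n = 0` for `p ≠ n` and `s n = 0` wherever `ℓ n > 0`.
* `lemmaK_identity`, `lemmaK_mass_bound` — Hall-DOWN (kernel) bookkeeping:
  `M⁺ n = Σ_p g n p + s n`, `M⁻ p = Σ_n g n p`; then `ℓ(E) = Σ_n s n ℓ n − Σ_{n,p} g n p (ℓ p − ℓ n)`, and
  `ℓ(E) = 0`, `ℓ ≤ ℓmax`, gap `≥ gmin` on used arcs give `gmin · Σ_p M⁻ p ≤ ℓmax · Σ_n s n`
  (P-mass ≤ rank · ℓ_max / g_min in the memo's words).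
* `rank_identity` — `Σ M⁺ − Σ M⁻ = Σ s` (both orientations).
* `linear_functional_bound` — `|Σ M⁺ n φ n − Σ M⁻ p φ p| ≤ Λ (Σ M⁺ + Σ M⁻)` for `|φ| ≤ Λ`, `M^± ≥ 0`
  (the Weil-coordinate bound `|σ₁ λ(E)| ≤ λ_max (N-mass + P-mass)`).
-/

set_option linter.dupNamespace false

namespace Summit.HodgeConjecture.HodgeConjecture.Cruxes.BlochSeedDiscOne.TwinHall

open Finset

variable {ι : Type*} [Fintype ι]

/-! ## LEMMA T (cokernel orientation) -/

/-- LEMMA T, the identity: substituting the two Hall-UP flow identities into `ℓ(E) = Σ M⁺ ℓ − Σ M⁻ ℓ`. -/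
theorem lemmaT_identity (ℓ : ι → ℚ) (f : ι → ι → ℚ) (s : ι → ℚ) :
    (∑ n, (∑ p, f p n + s n) * ℓ n) - ∑ p, (∑ n, f p n) * ℓ p
      = (∑ p, ∑ n, f p n * (ℓ n - ℓ p)) + ∑ n, s n * ℓ n := by
  have h1 : ∑ n, (∑ p, f p n + s n) * ℓ n = (∑ p, ∑ n, f p n * ℓ n) + ∑ n, s n * ℓ n := by
    simp only [add_mul, Finset.sum_add_distrib, Finset.sum_mul]
    congr 1
    exact Finset.sum_comm
  have h2 : ∑ p, (∑ n, f p n) * ℓ p = ∑ p, ∑ n, f p n * ℓ p := by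
    simp only [Finset.sum_mul]
  rw [h1, h2]
  have h3 : (∑ p, ∑ n, f p n * (ℓ n - ℓ p)) = (∑ p, ∑ n, f p n * ℓ n) - ∑ p, ∑ n, f p n * ℓ p := by
    simp only [mul_sub, Finset.sum_sub_distrib]
  rw [h3]
  ring

/-- LEMMA T, positivity: flows only go up in `ℓ` (`hsupp`), all data non-negative ⇒ `ℓ(E) ≥ 0`. -/
theorem lemmaT_nonneg (ℓ : ι → ℚ) (f : ι → ι → ℚ) (s : ι → ℚ)
    (hf : ∀ p n, 0 ≤ f p n) (hs : ∀ n, 0 ≤ s n) (hℓ : ∀ n, 0 ≤ ℓ n)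
    (hsupp : ∀ p n, f p n ≠ 0 → ℓ p ≤ ℓ n) :
    0 ≤ (∑ n, (∑ p, f p n + s n) * ℓ n) - ∑ p, (∑ n, f p n) * ℓ p := by
  rw [lemmaT_identity]
  apply add_nonneg
  · apply Finset.sum_nonneg
    intro p _
    apply Finset.sum_nonneg
    intro n _
    by_cases h : f p n = 0
    · simp [h]
    · exact mul_nonneg (hf p n) (sub_nonneg.mpr (hsupp p n h))
  · exact Finset.sum_nonneg (fun n _ => mul_nonneg (hs n) (hℓ n))

/-- LEMMA T, rigidity: if moreover used arcs between distinct cells go STRICTLY up in `ℓ` (`hstrict`) and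
`ℓ(E) = 0`, then there is no flow between distinct cells and no slack on cells of positive degree
(in the memo: `ch(E) = rank · 1`). -/
theorem lemmaT_rigid (ℓ : ι → ℚ) (f : ι → ι → ℚ) (s : ι → ℚ)
    (hf : ∀ p n, 0 ≤ f p n) (hs : ∀ n, 0 ≤ s n) (hℓ : ∀ n, 0 ≤ ℓ n)
    (hsupp : ∀ p n, f p n ≠ 0 → ℓ p ≤ ℓ n)
    (hstrict : ∀ p n, f p n ≠ 0 → p ≠ n → ℓ p < ℓ n)
    (h0 : (∑ n, (∑ p, f p n + s n) * ℓ n) - ∑ p, (∑ n, f p n) * ℓ p = 0) :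
    (∀ p n, p ≠ n → f p n = 0) ∧ (∀ n, 0 < ℓ n → s n = 0) := by
  rw [lemmaT_identity] at h0
  have hA : ∀ p, 0 ≤ ∑ n, f p n * (ℓ n - ℓ p) := by
    intro p
    apply Finset.sum_nonneg
    intro n _
    by_cases h : f p n = 0
    · simp [h]
    · exact mul_nonneg (hf p n) (sub_nonneg.mpr (hsupp p n h))
  have hApos : 0 ≤ ∑ p, ∑ n, f p n * (ℓ n - ℓ p) := Finset.sum_nonneg (fun p _ => hA p)
  have hBterm : ∀ n, 0 ≤ s n * ℓ n := fun n => mul_nonneg (hs n) (hℓ n)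
  have hBpos : 0 ≤ ∑ n, s n * ℓ n := Finset.sum_nonneg (fun n _ => hBterm n)
  have hA0 : ∑ p, ∑ n, f p n * (ℓ n - ℓ p) = 0 := by linarith
  have hB0 : ∑ n, s n * ℓ n = 0 := by linarith
  constructor
  · intro p n hpn
    by_contra hne
    have hrow : ∑ n, f p n * (ℓ n - ℓ p) = 0 :=
      (Finset.sum_eq_zero_iff_of_nonneg (fun p _ => hA p)).mp hA0 p (Finset.mem_univ p)
    have hterm : f p n * (ℓ n - ℓ p) = 0 := by
      have hnn : ∀ n ∈ (Finset.univ : Finset ι), 0 ≤ f p n * (ℓ n - ℓ p) := by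
        intro n _
        by_cases h : f p n = 0
        · simp [h]
        · exact mul_nonneg (hf p n) (sub_nonneg.mpr (hsupp p n h))
      exact (Finset.sum_eq_zero_iff_of_nonneg hnn).mp hrow n (Finset.mem_univ n)
    have hlt : ℓ p < ℓ n := hstrict p n hne hpn
    have hfpos : 0 < f p n := lt_of_le_of_ne (hf p n) (Ne.symm hne)
    have : 0 < f p n * (ℓ n - ℓ p) := mul_pos hfpos (by linarith)
    linarith
  · intro n hn
    have hterm : s n * ℓ n = 0 :=
      (Finset.sum_eq_zero_iff_of_nonneg (fun n _ => hBterm n)).mp hB0 n (Finset.mem_univ n)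
    rcases mul_eq_zero.mp hterm with h | h
    · exact h
    · exact absurd h (ne_of_gt hn)

/-! ## LEMMA K (kernel orientation) -/

/-- LEMMA K, the identity: Hall-DOWN bookkeeping `M⁺ n = Σ_p g n p + s n`, `M⁻ p = Σ_n g n p`
(flow `g n p` from the N-cell `n` to the P-cell `p` above it). -/
theorem lemmaK_identity (ℓ : ι → ℚ) (g : ι → ι → ℚ) (s : ι → ℚ) :
    (∑ n, (∑ p, g n p + s n) * ℓ n) - ∑ p, (∑ n, g n p) * ℓ p
      = (∑ n, s n * ℓ n) - ∑ n, ∑ p, g n p * (ℓ p - ℓ n) := by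
  have h1 : ∑ n, (∑ p, g n p + s n) * ℓ n = (∑ n, ∑ p, g n p * ℓ n) + ∑ n, s n * ℓ n := by
    simp only [add_mul, Finset.sum_add_distrib, Finset.sum_mul]
  have h2 : ∑ p, (∑ n, g n p) * ℓ p = ∑ n, ∑ p, g n p * ℓ p := by
    simp only [Finset.sum_mul]
    exact Finset.sum_comm
  rw [h1, h2]
  have h3 : (∑ n, ∑ p, g n p * (ℓ p - ℓ n)) = (∑ n, ∑ p, g n p * ℓ p) - ∑ n, ∑ p, g n p * ℓ n := by
    simp only [mul_sub, Finset.sum_sub_distrib]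
  rw [h3]
  ring

/-- LEMMA K, the counting bound: with `ℓ(E) = 0`, non-negative data, `ℓ ≤ ℓmax`, and every used arc gaining
at least `gmin` in degree (`hgap`; with `gmin > 0` this also says same-cell flow has been cancelled), the
total P-mass satisfies `gmin · Σ_p M⁻ p ≤ ℓmax · Σ_n s n` (= `ℓmax · rank`). -/
theorem lemmaK_mass_bound (ℓ : ι → ℚ) (g : ι → ι → ℚ) (s : ι → ℚ) (ℓmax gmin : ℚ)
    (hg : ∀ n p, 0 ≤ g n p) (hs : ∀ n, 0 ≤ s n) (hℓ : ∀ n, ℓ n ≤ ℓmax)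
    (hgap : ∀ n p, g n p ≠ 0 → gmin ≤ ℓ p - ℓ n)
    (h0 : (∑ n, (∑ p, g n p + s n) * ℓ n) - ∑ p, (∑ n, g n p) * ℓ p = 0) :
    gmin * ∑ p, ∑ n, g n p ≤ ℓmax * ∑ n, s n := by
  rw [lemmaK_identity] at h0
  have hflow : gmin * ∑ p, ∑ n, g n p ≤ ∑ n, ∑ p, g n p * (ℓ p - ℓ n) := by
    rw [Finset.sum_comm, Finset.mul_sum]
    apply Finset.sum_le_sum
    intro n _
    rw [Finset.mul_sum]
    apply Finset.sum_le_sum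
    intro p _
    by_cases h : g n p = 0
    · simp [h]
    · have := hgap n p h
      rw [mul_comm]
      exact mul_le_mul_of_nonneg_left this (hg n p)
  have hslack : ∑ n, s n * ℓ n ≤ ℓmax * ∑ n, s n := by
    rw [Finset.mul_sum]
    apply Finset.sum_le_sum
    intro n _
    rw [mul_comm ℓmax]
    exact mul_le_mul_of_nonneg_left (hℓ n) (hs n)
  linarith

/-! ## Rank identity and the linear-functional (Weil-coordinate) bound -/

/-- `Σ M⁺ − Σ M⁻ = Σ s` for the UP bookkeeping (for DOWN swap the roles of the two indices of the flow). -/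
theorem rank_identity (f : ι → ι → ℚ) (s : ι → ℚ) :
    (∑ n, (∑ p, f p n + s n)) - ∑ p, (∑ n, f p n) = ∑ n, s n := by
  rw [Finset.sum_add_distrib, Finset.sum_comm]
  ring

/-- The Weil-coordinate bound of LEMMA K (ii): for any functional `φ` with `|φ| ≤ Λ` cellwise and
non-negative multiplicities, `|Σ M⁺ φ − Σ M⁻ φ| ≤ Λ · (Σ M⁺ + Σ M⁻)`. -/
theorem linear_functional_bound (φ Mp Mm : ι → ℚ) (Λ : ℚ)
    (hΛ : ∀ i, |φ i| ≤ Λ) (hp : ∀ i, 0 ≤ Mp i) (hm : ∀ i, 0 ≤ Mm i) :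
    |(∑ i, Mp i * φ i) - ∑ i, Mm i * φ i| ≤ Λ * ((∑ i, Mp i) + ∑ i, Mm i) := by
  have h1 : |∑ i, Mp i * φ i| ≤ Λ * ∑ i, Mp i := by
    calc |∑ i, Mp i * φ i| ≤ ∑ i, |Mp i * φ i| := Finset.abs_sum_le_sum_abs _ _
      _ = ∑ i, Mp i * |φ i| := by
          apply Finset.sum_congr rfl; intro i _; rw [abs_mul, abs_of_nonneg (hp i)]
      _ ≤ ∑ i, Mp i * Λ := by
          apply Finset.sum_le_sum; intro i _; exact mul_le_mul_of_nonneg_left (hΛ i) (hp i)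
      _ = Λ * ∑ i, Mp i := by rw [Finset.mul_sum]; apply Finset.sum_congr rfl; intro i _; ring
  have h2 : |∑ i, Mm i * φ i| ≤ Λ * ∑ i, Mm i := by
    calc |∑ i, Mm i * φ i| ≤ ∑ i, |Mm i * φ i| := Finset.abs_sum_le_sum_abs _ _
      _ = ∑ i, Mm i * |φ i| := by
          apply Finset.sum_congr rfl; intro i _; rw [abs_mul, abs_of_nonneg (hm i)]
      _ ≤ ∑ i, Mm i * Λ := by
          apply Finset.sum_le_sum; intro i _; exact mul_le_mul_of_nonneg_left (hΛ i) (hm i)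
      _ = Λ * ∑ i, Mm i := by rw [Finset.mul_sum]; apply Finset.sum_congr rfl; intro i _; ring
  calc |(∑ i, Mp i * φ i) - ∑ i, Mm i * φ i|
      ≤ |∑ i, Mp i * φ i| + |∑ i, Mm i * φ i| := abs_sub _ _
    _ ≤ Λ * ∑ i, Mp i + Λ * ∑ i, Mm i := add_le_add h1 h2
    _ = Λ * ((∑ i, Mp i) + ∑ i, Mm i) := by ring

/-! ## Sanity instance (the numbers of the memo are NOT recomputed here; this only exercises the statements) -/

example : (4 : ℚ) * 256 / 32 = 32 := by norm_num      -- P-mass ≤ rank·ℓ_max/g_min on A₁₇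
example : (4 : ℚ) * (2 * 32 + 4) = 272 := by norm_num  -- |λ(E)| ≤ λ_max (2F + r) = 272 < 2003.5 < 4480

end Summit.HodgeConjecture.HodgeConjecture.Cruxes.BlochSeedDiscOne.TwinHall
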